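import Summits.QuantumFields.YangMills.Theorems.UV3BranchExpansionReadSetBounds
import Summits.QuantumFields.YangMills.Theorems.UV3BranchExpansionCountingAmortizedUniform
import HarnessLib

/-!
# `UV3BranchExpansionCountingT3` — THE AMORTIZED COUNT (C′) ON THE T³ TOWER: the seven geometric binders of
# `UV3BranchExpansionCountingAmortized(Uniform)` LEVEL-INDEXED along `T^{(j)} → ⋯ → T^{(j+n)}` and DISCHARGED, and the two counting theorems
# INSTANTIATED at `β i := PBond P (j+i)` (crux `UnitScaleTilt.HistoryTailL`, stmt-QuantumFields-19936 — SUPPLY side, record-independent lattice kinematics)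

Cell `ym3-torus` (YM ladder rung R3 = continuum SU(2) Yang–Mills on T³ — a RUNG, NOT d = 4, NOT infinite volume, NOT a mass gap, NOT Clay);
width seat `ym-ust-19936-w5` (gen 19), explicit-unit helper; `--supports stmt-QuantumFields-19936 --as helper`.  THEOREMS ONLY (0 `def`,
0 `sorry`, default heartbeats).

WHAT.  ✓`UV3BranchExpansionReadSetBounds` (p760492) discharges, for ONE blocking step `k → k+1` in the standing range, the seven
pattern-independent hypotheses `hctr hline hdisj hpriv hR hρ hcap` of w2 g17's amortized covering count (LEAD ★w1's hTop spine, note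
`Cruxes/HistoryTailL/HTopBranchExpansion.md` v1.2 §5–§6; FINDING #51's route of record (C′)), with `r₀ = 2dL^d`, `ρ₀ = 2d`, `s₀ = (2d−1)(L−1)`.
The (F-TOP) assembly over the (E)-model socket ✓`UV3BranchExpansionGuardedTower` instantiates that count on the tower `β i := PBond P (j+i)`
(switch sites = the sigma fibres `PBond P (j+i+1)`), where the binders are needed — and, beyond the standing range, available — at the levels
`i < n` ONLY (beyond `m + K` the torus has `2` sites per direction and no family of `#PBond(j+i+1)` pairwise-disjoint `L`-bond segments; hence
the `∀ i, i < n → …` re-cut of ✓`…CountingAmortized` v1.1 ∕ ✓`…CountingAmortizedUniform`).  THIS FILE: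
* §1 `mem_image_line_iff` · `subset_of_mem_filter_or` — the canonical inline choices `(range L).image (line g)` and any finset cut out of
  «loop-word bonds ∪ own segment» satisfy the specification letters `hlineF`∕`hRd` (so (F-TOP) may write them without a `def`).
* §2 ★ `centralBond_mem_levels` (hctr) · ★ `card_line_levels` (hline) · ★ `disjoint_line_levels` (hdisj) · ★ `priv_levels` (hpriv) ·
  ★★ `card_readSet_levels` (hR) · ★★ `card_readers_levels` (hρ) · ★★★ `card_sideSlots_levels` (hcap) — each `∀ i, i < n → …` at
  `β i := PBond P (j+i)`, `ctr i := centralBond`, under the single range letter `hjn : j + n ≤ m + K`; `line_subset_readSet_levels` (the (M′)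
  letter `hRline`, from the ⊇ half of the read-set letter).
* §3 ★★★ **`sum_pow_card_le_of_discoverable_T3`** (= ✓`sum_pow_card_le_of_discoverable_of_lt` on the tower: `Σ_{𝐬 discoverable} x^{|𝐬|} ≤
  (1 + D_n)^{#PBond(j+n)}` for any `D ≥ 0` dominating the multiplier recursion AT THE LATTICE CONSTANTS) and ★★★ **`sum_pow_card_le_exp_of_smallness_T3`**
  (= ✓`sum_pow_card_le_exp_of_smallness` on the tower: `… ≤ exp(#PBond(j+n) · (2/(1−θ₀)) · x / y^{(2d−1)(L−1)})`, `n`-UNIFORM) — every geometric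
  binder DISCHARGED; displayed remain the range letter, the pattern letters `Dist X N` with their definitional recursions (`hDist0 hDistS hXm hXS hN`,
  (F-TOP)'s ONE recursion — px8 g13's ✓`UV3BranchExpansionDistortedSet` `hDj`∕`hDsucc` re-indexed `k = j + i`), the specification letters
  `hlineF`∕`hRd`, and the smallness rows (`∃ θ₀ < 1`-shaped; numerals live in the memo: d = L = 3 gives `r₀ = 162, ρ₀ = 6, s₀ = 10`).

HONEST SCOPE.  Re-indexing and instantiation of landed theorems; nothing of (M) ∕ (F-M2) ∕ (F-TOP)'s measure side, hTop, the χ (α) record,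
(O‴χₛ), EX, `HistoryTailL`, the rung R3 is proved; the Yang–Mills mass gap is NOT proved.

References: T. Bałaban, CMP **109** (1987) 249–301 [Balaban1987RG1] ((0.4) p. 253); T. Bałaban, CMP **95** (1984) 17–40 [Balaban1984PropagatorsI]
((1.7) p. 18); T. Bałaban, CMP **102** (1985) 255–275 [Balaban1985UV3] ((47) p. 268, (55) p. 269); LEAD note `Cruxes/HistoryTailL/HTopBranchExpansion.md`
v1.2 §5–§6; w2 g17 ✓`UV3BranchExpansionCountingAmortized(Uniform)`; px13 g13 ✓`UV3BranchExpansionCountingRecursion.exists_amortised_envelope`.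
-/

set_option autoImplicit false

namespace Summit.QuantumFields.YangMills.Theorems.UV3BranchExpansionCountingT3

open Finset
open Literature.MathematicalPhysics.QuantumFieldTheory.Balaban1983to89
open Literature.MathematicalPhysics.QuantumFieldTheory.Balaban1983to89.T4Continuum
open Literature.MathematicalPhysics.QuantumFieldTheory.Balaban1983to89.AveragingRT
open Literature.MathematicalPhysics.QuantumFieldTheory.Balaban1983to89.BlockAveraging
open Literature.MathematicalPhysics.QuantumFieldTheory.Balaban1983to89.BlockAveragingHaarAC
open Summit.QuantumFields.YangMills.Theorems.UV3BranchExpansionReadSetBounds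
open Summit.QuantumFields.YangMills.Theorems.UV3BranchExpansionCountingAmortized (sum_pow_card_le_of_discoverable_of_lt)
open Summit.QuantumFields.YangMills.Theorems.UV3BranchExpansionCountingAmortizedUniform (sum_pow_card_le_exp_of_smallness)

variable {P : Params} {j n : ℕ}

/-! ## §1 The canonical inline families satisfy the two specification hypotheses -/

/-- The image of `range L` under `t ↦ line g t` is specified by `b ∈ · ↔ ∃ t < L, b = line g t` (the `hlineF` letter). [folklore] -/
theorem mem_image_line_iff {k : ℕ} [DecidableEq (PBond P k)] (g : PBond P (k + 1)) (b : PBond P k) :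
    b ∈ (Finset.range P.L).image (line g) ↔ ∃ t < P.L, b = line g t := by
  rw [Finset.mem_image]
  constructor
  · rintro ⟨t, ht, rfl⟩
    exact ⟨t, Finset.mem_range.mp ht, rfl⟩
  · rintro ⟨t, ht, rfl⟩
    exact ⟨t, Finset.mem_range.mpr ht, rfl⟩

/-- Any finset cut out of «the loop-word bonds of `c` ∪ the segment of `c`» by a further condition satisfies the `hRd` containment letter. [folklore] -/
theorem subset_of_mem_filter_or {k : ℕ} (c : PBond P (k + 1)) (S : Finset (PBond P k)) (q : PBond P k → Prop) [DecidablePred q]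
    (hS : ∀ b ∈ S, (∃ i : Idx P, ∃ s ∈ walk (emb c.src) (loopWord P.L c.dir (off i.1) i.2.1 i.2.2), s.bond = b) ∨ ∃ t < P.L, b = line c t)
    (b : PBond P k) (hb : b ∈ S.filter q) :
    (∃ i : Idx P, ∃ s ∈ walk (emb c.src) (loopWord P.L c.dir (off i.1) i.2.1 i.2.2), s.bond = b) ∨ ∃ t < P.L, b = line c t :=
  hS b (Finset.mem_filter.mp hb).1

/-! ## §2 The seven binders along the tower, `∀ i, i < n → …` -/

section Levels

variable (hjn : j + n ≤ P.m + P.K) [∀ k, DecidableEq (PBond P k)]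
  (lineF : (i : ℕ) → PBond P (j + i + 1) → Finset (PBond P (j + i)))
  (hlineF : ∀ i (g : PBond P (j + i + 1)) (b : PBond P (j + i)), b ∈ lineF i g ↔ ∃ t < P.L, b = line g t)
  (Rd : (i : ℕ) → PBond P (j + i + 1) → Finset (PBond P (j + i)))
  (hRd : ∀ i (c : PBond P (j + i + 1)) (b : PBond P (j + i)), b ∈ Rd i c →
    (∃ ι : Idx P, ∃ s ∈ walk (emb c.src) (loopWord P.L c.dir (off ι.1) ι.2.1 ι.2.2), s.bond = b) ∨ ∃ t < P.L, b = line c t)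
include hlineF

omit [∀ k, DecidableEq (PBond P k)] in
/-- ★ `hctr` along the tower: `centralBond g ∈ lineF i g`. [cite: Balaban1987RG1, (0.4) p.253] -/
theorem centralBond_mem_levels : ∀ i, i < n → ∀ g : PBond P (j + i + 1), centralBond g ∈ lineF i g :=
  fun i _ g => centralBond_mem_lineF (lineF i) (hlineF i) g

include hjn

/-- ★ `hline` along the tower: every segment has `L` bonds, at every level `i < n` (standing range from `j + n ≤ m + K`). [cite: Balaban1984PropagatorsI, (1.7) p.18] -/
theorem card_line_levels : ∀ i, i < n → ∀ g : PBond P (j + i + 1), (lineF i g).card = P.L :=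
  fun i hi g => card_lineF (by omega) (lineF i) (hlineF i) g

omit [∀ k, DecidableEq (PBond P k)] in
/-- ★ `hdisj` along the tower: distinct segments are disjoint, at every level `i < n`. [cite: Balaban1984PropagatorsI, (1.7) p.18] -/
theorem disjoint_line_levels :
    ∀ i, i < n → ∀ g g' : PBond P (j + i + 1), g ≠ g' → Disjoint (lineF i g) (lineF i g') :=
  fun i hi _ _ hne => disjoint_lineF (by omega) (lineF i) (hlineF i) hne

omit hlineF
include hRd

omit [∀ k, DecidableEq (PBond P k)] in
/-- ★ `hpriv` along the tower: the crossing bond of `g` is read only by `g`, at every level `i < n`. [cite: Balaban1987RG1, (0.4) p.253] -/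
theorem priv_levels : ∀ i, i < n → ∀ (g c : PBond P (j + i + 1)), centralBond g ∈ Rd i c → c = g :=
  fun i hi _ _ h => eq_of_centralBond_mem (by omega) (Rd i) (hRd i) h

/-- ★★ `hR` along the tower: `|R(c)| ≤ 2·d·L^d` at every level `i < n`. [cite: Balaban1987RG1, (0.4) p.253] -/
theorem card_readSet_levels : ∀ i, i < n → ∀ c : PBond P (j + i + 1), (Rd i c).card ≤ 2 * P.d * P.L ^ P.d :=
  fun i hi c => card_readSet_le (by omega) (Rd i) (hRd i) c

/-- ★★ `hρ` along the tower: every fine bond has at most `2d` readers, at every level `i < n`. [cite: Balaban1987RG1, (0.4) p.253] -/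
theorem card_readers_levels :
    ∀ i, i < n → ∀ b : PBond P (j + i), (Finset.univ.filter (fun c : PBond P (j + i + 1) => b ∈ Rd i c)).card ≤ 2 * P.d :=
  fun i hi b => card_readers_le (by omega) (Rd i) (hRd i) b

include hlineF

/-- ★★★ `hcap` along the tower: the reader capacity `(2d − 1)(L − 1)` at every level `i < n`. [cite: Balaban1987RG1, (0.4) p.253] -/
theorem card_sideSlots_levels :
    ∀ i, i < n → ∀ c : PBond P (j + i + 1),
      (((Finset.univ.erase c).biUnion (fun g => (lineF i g).erase (centralBond g))) ∩ Rd i c).card ≤ (2 * P.d - 1) * (P.L - 1) :=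
  fun i hi c => card_sideSlots_inter_readSet_le (by omega) (lineF i) (hlineF i) (Rd i) (hRd i) c

omit hjn hRd [∀ k, DecidableEq (PBond P k)] in
/-- `hRline` along the tower (the (M′) letter of ✓`mem_explored_union_of_tower_of_lt`): if the read set CONTAINS «loop-word bonds ∪ own segment»
(the ⊇ half of the model read-set letter), every segment lies in the read set of its own coarse bond. [cite: Balaban1987RG1, (0.4) p.253] -/
theorem line_subset_readSet_levels
    (hRdsup : ∀ i (c : PBond P (j + i + 1)) (b : PBond P (j + i)),
      ((∃ ι : Idx P, ∃ s ∈ walk (emb c.src) (loopWord P.L c.dir (off ι.1) ι.2.1 ι.2.2), s.bond = b) ∨ ∃ t < P.L, b = line c t) → b ∈ Rd i c) :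
    ∀ i, i < n → ∀ g : PBond P (j + i + 1), lineF i g ⊆ Rd i g :=
  fun i _ g b hb => hRdsup i g b (Or.inr ((hlineF i g b).mp hb))

end Levels

/-! ## §3 The amortized count on the T³ tower: every geometric binder discharged -/

section Count

variable (hjn : j + n ≤ P.m + P.K) [∀ k, DecidableEq (PBond P k)]
  (lineF : (i : ℕ) → PBond P (j + i + 1) → Finset (PBond P (j + i)))
  (hlineF : ∀ i (g : PBond P (j + i + 1)) (b : PBond P (j + i)), b ∈ lineF i g ↔ ∃ t < P.L, b = line g t)
  (Rd : (i : ℕ) → PBond P (j + i + 1) → Finset (PBond P (j + i)))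
  (hRd : ∀ i (c : PBond P (j + i + 1)) (b : PBond P (j + i)), b ∈ Rd i c →
    (∃ ι : Idx P, ∃ s ∈ walk (emb c.src) (loopWord P.L c.dir (off ι.1) ι.2.1 ι.2.2), s.bond = b) ∨ ∃ t < P.L, b = line c t)
  (Dist : ((i : Fin n) → Finset (PBond P (j + i + 1))) → (i : ℕ) → Finset (PBond P (j + i)))
  (X : (m : ℕ) → Finset (PBond P (j + m)) → ((i : Fin n) → Finset (PBond P (j + i + 1))) → (i : ℕ) → Finset (PBond P (j + i)))
  (N : (i : ℕ) → Finset (PBond P (j + i + 1)) → Finset (PBond P (j + i + 1)))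
include hjn hlineF hRd

/-- ★★★ **THE AMORTIZED COVERING INEQUALITY ON THE T³ TOWER.**  For the blocking tower `T^{(j)} → ⋯ → T^{(j+n)}` of lit `Setup` in the standing range
(`j + n ≤ m + K`), segments `lineF` and (0.4)-guard read sets `Rd` as specified, pattern letters `Dist`, `X`, `N` obeying their recursions, and any
`D ≥ 0` dominating the multiplier recursion at the LATTICE constants `r₀ = 2dL^d`, `ρ₀ = 2d`, `s₀ = (2d−1)(L−1)`:
`Σ_{𝐬 discoverable from Dist 𝐬 n} x^{|𝐬|} ≤ (1 + D n)^{#PBond(j+n)}` — ✓`sum_pow_card_le_of_discoverable_of_lt` at `β i := PBond P (j+i)`,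
`ctr i := centralBond`, with `hctr hline hdisj hpriv hR hρ hcap` supplied by §2. [cite: Balaban1987RG1, (0.4) p.253; Balaban1985UV3, (55) p.269] -/
theorem sum_pow_card_le_of_discoverable_T3
    (hDist0 : ∀ p, Dist p 0 = ∅)
    (hDistS : ∀ p (i : Fin n) (g : PBond P (j + i + 1)),
      g ∈ Dist p ((i : ℕ) + 1) ↔ g ∈ p i ∨ lineF i g ⊆ Dist p i ∪ (p i).biUnion (Rd i))
    (hXm : ∀ m (A : Finset (PBond P (j + m))) p, X m A p m = A)
    (hXS : ∀ m (A : Finset (PBond P (j + m))) p (i : Fin n), (i : ℕ) < m →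
      X m A p i = ((X m A p ((i : ℕ) + 1) \ p i).biUnion (lineF i) ∪ (p i).biUnion (Rd i)) ∩ Dist p i)
    (hN : ∀ i G c, c ∈ N i G ↔ ∃ g ∈ G, ∃ b ∈ (lineF i g).erase (centralBond g), b ∈ Rd i c)
    {x y : ℝ} (hx : 0 ≤ x) (hy : 0 < y) (hy1 : y ≤ 1) {D : ℕ → ℝ} (hD : ∀ i, 0 ≤ D i)
    (hstep : ∀ i, i < n →
      x / y ^ ((2 * P.d - 1) * (P.L - 1)) * (1 + D i) ^ (2 * P.d * P.L ^ P.d) +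
        D i * (y + D i) ^ (P.L - 1) * (1 + x / y ^ ((2 * P.d - 1) * (P.L - 1)) / y * (1 + D i) ^ (2 * P.d * P.L ^ P.d))
          ^ ((P.L - 1) * (2 * P.d)) ≤ D (i + 1)) :
    ∑ p ∈ (Finset.univ : Finset ((i : Fin n) → Finset (PBond P (j + i + 1)))).filter
        (fun p => ∀ i : Fin n, p i ⊆ X n (Dist p n) p ((i : ℕ) + 1) ∪ N i (X n (Dist p n) p ((i : ℕ) + 1) \ p i)),
      x ^ (∑ i : Fin n, (p i).card) ≤ (1 + D n) ^ Fintype.card (PBond P (j + n)) :=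
  sum_pow_card_le_of_discoverable_of_lt (β := fun i => PBond P (j + i)) Rd lineF (fun _ g => centralBond g) Dist X N
    (centralBond_mem_levels lineF hlineF) (card_line_levels hjn lineF hlineF) (disjoint_line_levels hjn lineF hlineF)
    (priv_levels hjn Rd hRd) (card_readSet_levels hjn Rd hRd) (card_readers_levels hjn Rd hRd)
    (card_sideSlots_levels hjn lineF hlineF Rd hRd) hDist0 hDistS hXm hXS hN hx hy hy1 hD hstep

/-- ★★★ **THE AMORTIZED COUNT WITH ITS LEVEL-UNIFORM CONSTANT, ON THE T³ TOWER.**  Same data; if the two smallness rows hold at the lattice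
constants (`∃ θ₀ < 1`-shaped, WORD 89 (5)(c); numerals only in the memo), then
`Σ_{𝐬 discoverable} x^{|𝐬|} ≤ exp(#PBond(j+n) · (2/(1−θ₀)) · x / y^{(2d−1)(L−1)})`, the RHS independent of the number `n` of levels —
✓`sum_pow_card_le_exp_of_smallness` (w2 g17, over px13 g13's ✓`exists_amortised_envelope`) at `β i := PBond P (j+i)` with §2's binders.  This is
the prefactor instance the (F-TOP) assembly of hTop composes with the socket ✓`map_iterFrom_le_smul_of_branchExpansion`, (F-M2)'s `hM` and
(F-TOP-hw)'s `hw`. [cite: Balaban1987RG1, (0.4) p.253; Balaban1985UV3, (55) p.269] -/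
theorem sum_pow_card_le_exp_of_smallness_T3
    (hDist0 : ∀ p, Dist p 0 = ∅)
    (hDistS : ∀ p (i : Fin n) (g : PBond P (j + i + 1)),
      g ∈ Dist p ((i : ℕ) + 1) ↔ g ∈ p i ∨ lineF i g ⊆ Dist p i ∪ (p i).biUnion (Rd i))
    (hXm : ∀ m (A : Finset (PBond P (j + m))) p, X m A p m = A)
    (hXS : ∀ m (A : Finset (PBond P (j + m))) p (i : Fin n), (i : ℕ) < m →
      X m A p i = ((X m A p ((i : ℕ) + 1) \ p i).biUnion (lineF i) ∪ (p i).biUnion (Rd i)) ∩ Dist p i)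
    (hN : ∀ i G c, c ∈ N i G ↔ ∃ g ∈ G, ∃ b ∈ (lineF i g).erase (centralBond g), b ∈ Rd i c)
    {x y θ₀ : ℝ} (hx : 0 ≤ x) (hy : 0 < y) (hy1 : y ≤ 1) (hθ₀ : θ₀ < 1)
    (hsmallE : (1 + 2 / (1 - θ₀) * (x / y ^ ((2 * P.d - 1) * (P.L - 1)))) ^ (2 * P.d * P.L ^ P.d) ≤ 2)
    (hsmallG : (y + 2 / (1 - θ₀) * (x / y ^ ((2 * P.d - 1) * (P.L - 1)))) ^ (P.L - 1) *
      (1 + 2 * (x / y ^ ((2 * P.d - 1) * (P.L - 1))) / y) ^ ((P.L - 1) * (2 * P.d)) ≤ θ₀) :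
    ∑ p ∈ (Finset.univ : Finset ((i : Fin n) → Finset (PBond P (j + i + 1)))).filter
        (fun p => ∀ i : Fin n, p i ⊆ X n (Dist p n) p ((i : ℕ) + 1) ∪ N i (X n (Dist p n) p ((i : ℕ) + 1) \ p i)),
      x ^ (∑ i : Fin n, (p i).card)
        ≤ Real.exp (Fintype.card (PBond P (j + n)) * (2 / (1 - θ₀) * (x / y ^ ((2 * P.d - 1) * (P.L - 1))))) :=
  sum_pow_card_le_exp_of_smallness (β := fun i => PBond P (j + i)) Rd lineF (fun _ g => centralBond g) Dist X N
    (centralBond_mem_levels lineF hlineF) (card_line_levels hjn lineF hlineF) (disjoint_line_levels hjn lineF hlineF)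
    (priv_levels hjn Rd hRd) (card_readSet_levels hjn Rd hRd) (card_readers_levels hjn Rd hRd)
    (card_sideSlots_levels hjn lineF hlineF Rd hRd) hDist0 hDistS hXm hXS hN hx hy hy1 hθ₀ hsmallE hsmallG

end Count

end Summit.QuantumFields.YangMills.Theorems.UV3BranchExpansionCountingT3
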